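import Mathlib
import Literature.AlgebraicGeometry.ShimuraVarieties.UnitaryBallQuotientDatum
import HarnessLib

/-!
# The unitary group of a hermitian line over the split quadratic algebra `F × F` is `Fˣ`

Topic `NumberTheory/QuadraticForms`; namespace `Literature.NumberTheory.QuadraticForms` with the grouping
sub-namespace `SplitUnitaryLine` (it names the object: a hermitian LINE over the SPLIT quadratic algebra).
Setting: `F` a commutative ring and the split quadratic `F`-algebra `E = F × F` with its involution the
FLIP `(a, b) ↦ (b, a)` — the shape of `L ⊗_{L₀} L_{0,v}` at a place `v` of `L₀` that splits in a quadratic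
(e.g. CM) extension `L/L₀`. Mok, *Endoscopic classification of representations of quasi-split unitary
groups*, §1 Notation (p. 5): "it will be convenient to include the case where `E` is a split quadratic
separable extension of `F`, i.e. `E = F × F`, with the conjugation of `E` over `F` being given by the
interchange of the two factors. We then have `U_{E/F}(N) ≅ GL_{N/F}` … `ι₁` induced by the projection of
`E` to the left `F` factor", and `ι₂ ∘ ι₁⁻¹ : g ↦ J ᵗg⁻¹ J⁻¹`. This file is the case `N = 1` (a hermitian
line, where the form cancels), proved:

* §1 `conj F : (F × F) ≃+* (F × F)` the flip (`RingEquiv.prodComm`), an involution (`conj_conj`);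
  `normMap F : (F × F)ˣ →* (F × F)ˣ`, `g ↦ g · conj g`; the norm-one group
  `unitaryGroup F : Subgroup (F × F)ˣ := (normMap F).ker` with
  `mem_unitaryGroup_iff : g ∈ unitaryGroup F ↔ g * conj F g = 1` and
  `mem_unitaryGroup_iff_fst_mul_snd : … ↔ g.1 * g.2 = 1`;
* §2 `toUnits F : unitaryGroup F →* Fˣ` (Mok's `ι₁`, first projection), `ofUnits F : Fˣ →* unitaryGroup F`
  (`a ↦ (a, a⁻¹)`, through `pairUnit`), **`unitaryGroupEquiv F : unitaryGroup F ≃* Fˣ`**, and the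
  coordinate description `coe_eq_pair : g = (a, a⁻¹)` (Mok's `ι₂ ∘ ι₁⁻¹ = (g ↦ ᵗg⁻¹)` for `N = 1`);
* §3 the same for the tree's unitary group of a Gram matrix,
  `Literature.AlgebraicGeometry.ShimuraVarieties.unitaryGroup σ H ≤ GL m R` (`(σg)ᵀ H g = H`,
  `UnitaryBallQuotientDatum.lean`), for a NON-DEGENERATE hermitian LINE over the split algebra (`m` a
  one-point index type, `H = (δ)` with `δ` a unit, `σ = conj F`): `matrixUniqueEquiv : Matrix m m R ≃+* R`
  and `glUniqueEquiv : GL m R ≃* Rˣ` (for an ARBITRARY `[Fintype m]` instance — Mathlib's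
  `Matrix.uniqueRingEquiv` is stated over `Unique.fintype`, cf. the same restatement
  `FramedRep.unitsContinuousMulEquivOfUnique` in `GaloisRepresentations/GaloisRep.lean`),
  `mem_unitaryGroup_line_iff : g ∈ U(H) ↔ σ(g₁₁) g₁₁ = 1` (the form cancels),
  `map_glUniqueEquiv_unitaryGroup : U(H).map glUniqueEquiv = unitaryGroup F`,
  **`packageLineEquiv F H hH : ShimuraVarieties.unitaryGroup (conj F) H ≃* Fˣ`** and
  `entry_eq_pair : g₁₁ = (a, a⁻¹)`.

Pure algebra over Mathlib; every declaration is proved; axioms ⊆ the standard trio.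

RELATION TO `NumberTheory/Automorphic/UnitaryGroupSplitPlace.lean`: that file proves the split-place
isomorphism `UnitaryGroup.localPiSplitEquiv : localPi E c N J v ≃ₜ* GL (Fin N) (E_w)` for the local factor
`U(J)(F_v) ≤ Π_{w ∣ v} GL_N(E_w)` of a GLOBAL unitary group at a split place (general `N`, completions of a
number field); the present file is the abstract algebraic statement over the split algebra `F × F` of an
arbitrary commutative ring, rank one, in the two shapes (`(F × F)ˣ` with the flip; `GL₁` of a Gram matrix)
in which hermitian lines arrive in local-factor computations. Neither is a special case of the other by
`rfl`. Novelty check (`lean search --decl`, grep of `Literature/NumberTheory/QuadraticForms`, 2026-08-18):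
no `normMap` / `pairUnit` / `glUniqueEquiv` / split-algebra `unitaryGroup` in the tree or Mathlib.
Deliberately NOT here: integral points / level structure and the topological upgrade `≃ₜ*` over a normed
field (the cell's `LocalFactors/SplitLevel.lean`), higher rank, non-split places.

## Provenance

Reproduced for the tree under the LEAN-IN-TREE rule (2026-08-18) from the pub-hodgecm cell's package file
`HodgeCM/PerL34/LocalFactors/SplitUnitaryLine.lean` (DAG-node prover #07 lineage, seat pv07 gen 2, gate
run 25; 234 lines, 33 declarations), statements and proofs verbatim and declaration names kept (the cell's
import `HodgeCM.Vendored.Hermitian` is an excerpt of the tree's `UnitaryBallQuotientDatum.lean`; the name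
`packageLineEquiv` refers to that "package" unitary group `unitaryGroup σ H`); namespace and docstrings
adapted; port by seat pv07 gen 6. Nothing in this file is a claim of the manuscripts adjudicated by that
cell.

## References

* C. P. Mok, *Endoscopic classification of representations of quasi-split unitary groups*, Mem. AMS 235
  no. 1108 (2015) = arXiv:1206.0882, §1 Notation, p. 5 (`E = F × F`, `U_{E/F}(N) ≅ GL_{N/F}` via `ι₁`;
  `ι₂ ∘ ι₁⁻¹ = (g ↦ J ᵗg⁻¹ J⁻¹)`) [Mok2014].
* N. Bergeron, J. Millson, C. Moeglin, *The Hodge conjecture and arithmetic quotients of complex balls*,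
  Acta Math. 216 (2016), Part 2 §1.2 (the unitary group `(σg)ᵀ H g = H` of a hermitian Gram matrix, as
  rendered in `UnitaryBallQuotientDatum.lean`) [BergeronMillsonMoeglin2016Balls].
-/

set_option autoImplicit false

namespace Literature.NumberTheory.QuadraticForms

namespace SplitUnitaryLine

variable (F : Type*) [CommRing F]

/-! ### §1 The split quadratic algebra `F × F`, its flip, norm map and norm-one group -/

/-- Complex conjugation of the split quadratic algebra `E = F × F` (`= L ⊗_{L₀} L_{0,v}` at a split
place): the flip `(a, b) ↦ (b, a)` (Mathlib's `RingEquiv.prodComm`).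
[cite: Mok2014, §1 Notation p. 5] -/
def conj : (F × F) ≃+* (F × F) := RingEquiv.prodComm

/-- `conj (a, b) = (b, a)` (definitional). [folklore] -/
@[simp] theorem conj_apply (x : F × F) : conj F x = (x.2, x.1) := rfl

/-- The flip is an involution (definitional). [folklore] -/
@[simp] theorem conj_conj (x : F × F) : conj F (conj F x) = x := rfl

/-- The norm map `g ↦ g · ḡ` on the units of the split algebra (a homomorphism since `F × F` is
commutative). [folklore] -/
def normMap : (F × F)ˣ →* (F × F)ˣ where
  toFun g := g * Units.map (conj F : (F × F) →* (F × F)) g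
  map_one' := by rw [map_one, mul_one]
  map_mul' g h := by rw [map_mul]; exact mul_mul_mul_comm _ _ _ _

/-- `normMap g = g * conj g` on underlying elements (definitional). [folklore] -/
@[simp] theorem coe_normMap (g : (F × F)ˣ) : (normMap F g : F × F) = (g : F × F) * conj F g := rfl

/-- The unitary group `U_{E/F}(1)` of the split algebra `E = F × F` with the flip: the norm-one units
`{g ∈ (F × F)ˣ : g ḡ = 1}` (the unitary group of ANY non-degenerate hermitian line over `E`, the form
cancelling — see `map_glUniqueEquiv_unitaryGroup`). [cite: Mok2014, §1 Notation p. 5] -/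
def unitaryGroup : Subgroup (F × F)ˣ := (normMap F).ker

variable {F}

/-- Membership: `g ∈ U ↔ g · ḡ = 1`. [folklore] -/
theorem mem_unitaryGroup_iff (g : (F × F)ˣ) :
    g ∈ unitaryGroup F ↔ (g : F × F) * conj F g = 1 := by
  rw [unitaryGroup, MonoidHom.mem_ker, ← Units.val_eq_one, coe_normMap]

/-- Membership in coordinates: `(a, b) ∈ U ↔ a b = 1`. [folklore] -/
theorem mem_unitaryGroup_iff_fst_mul_snd (g : (F × F)ˣ) :
    g ∈ unitaryGroup F ↔ (g : F × F).1 * (g : F × F).2 = 1 := by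
  rw [mem_unitaryGroup_iff, Prod.ext_iff]
  change (g : F × F).1 * (g : F × F).2 = 1 ∧ (g : F × F).2 * (g : F × F).1 = 1 ↔ _
  rw [mul_comm (g : F × F).2, and_self]

/-- For `(a, b) ∈ U`: `a b = 1`. [folklore] -/
theorem fst_mul_snd_of_mem {g : (F × F)ˣ} (hg : g ∈ unitaryGroup F) :
    (g : F × F).1 * (g : F × F).2 = 1 :=
  (mem_unitaryGroup_iff_fst_mul_snd g).1 hg

variable (F)

/-! ### §2 `U_{E/F}(1) ≃* Fˣ` by the first projection -/

/-- Mok's `ι₁` for `N = 1`: the first projection `U → Fˣ`, `(a, b) ↦ a`.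
[cite: Mok2014, §1 Notation p. 5] -/
def toUnits : unitaryGroup F →* Fˣ :=
  (Units.map (RingHom.fst F F : (F × F) →* F)).comp (unitaryGroup F).subtype

/-- `toUnits g = g.1` on underlying elements (definitional). [folklore] -/
@[simp] theorem coe_toUnits (g : unitaryGroup F) :
    (toUnits F g : F) = ((g : (F × F)ˣ) : F × F).1 := rfl

/-- The second coordinate of `g ∈ U` is the inverse of the first (Mok's `ι₂ ∘ ι₁⁻¹ = (g ↦ ᵗg⁻¹)` for
`N = 1`). [cite: Mok2014, §1 Notation p. 5] -/
theorem coe_toUnits_inv (g : unitaryGroup F) :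
    ((toUnits F g)⁻¹ : Fˣ) = (((g : (F × F)ˣ) : F × F).2 : F) :=
  Units.inv_eq_of_mul_eq_one_right (fst_mul_snd_of_mem g.2)

/-- The unit `(a, a⁻¹)` of `F × F`. [folklore] -/
def pairUnit (a : Fˣ) : (F × F)ˣ :=
  ⟨((a : F), ((a⁻¹ : Fˣ) : F)), (((a⁻¹ : Fˣ) : F), (a : F)), Prod.ext a.mul_inv a.inv_mul,
    Prod.ext a.inv_mul a.mul_inv⟩

/-- `pairUnit a = (a, a⁻¹)` on underlying elements (definitional). [folklore] -/
@[simp] theorem coe_pairUnit (a : Fˣ) :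
    (pairUnit F a : F × F) = ((a : F), ((a⁻¹ : Fˣ) : F)) := rfl

/-- `(a, a⁻¹) ∈ U`. [folklore] -/
theorem pairUnit_mem (a : Fˣ) : pairUnit F a ∈ unitaryGroup F :=
  (mem_unitaryGroup_iff_fst_mul_snd _).2 a.mul_inv

/-- The inverse map `Fˣ → U`, `a ↦ (a, a⁻¹)` (Mok's `ι₁⁻¹` for `N = 1`). [folklore] -/
def ofUnits : Fˣ →* unitaryGroup F where
  toFun a := ⟨pairUnit F a, pairUnit_mem F a⟩
  map_one' := Subtype.ext <| Units.ext <| Prod.ext rfl (by simp)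
  map_mul' a b := Subtype.ext <| Units.ext <| Prod.ext rfl (by simp [mul_comm])

/-- `ofUnits a = (a, a⁻¹)` on underlying elements (definitional). [folklore] -/
@[simp] theorem coe_ofUnits (a : Fˣ) :
    (((ofUnits F a : unitaryGroup F) : (F × F)ˣ) : F × F) = ((a : F), ((a⁻¹ : Fˣ) : F)) := rfl

/-- `toUnits (ofUnits a) = a`. [folklore] -/
@[simp] theorem toUnits_ofUnits (a : Fˣ) : toUnits F (ofUnits F a) = a := Units.ext rfl

/-- `ofUnits (toUnits g) = g`. [folklore] -/
@[simp] theorem ofUnits_toUnits (g : unitaryGroup F) : ofUnits F (toUnits F g) = g :=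
  Subtype.ext <| Units.ext <| Prod.ext rfl (coe_toUnits_inv F g)

/-- **`U_{E/F}(1) ≃* Fˣ` for the split algebra `E = F × F`**: the unitary group of a hermitian line over
the split quadratic algebra is the multiplicative group of the base ring, via the first projection
(Mok: `U_{E/F}(N) ≅ GL_{N/F}` via `ι₁`, case `N = 1`). [cite: Mok2014, §1 Notation p. 5] -/
def unitaryGroupEquiv : unitaryGroup F ≃* Fˣ :=
  { toUnits F with
    invFun := ofUnits F
    left_inv := ofUnits_toUnits F
    right_inv := toUnits_ofUnits F }

/-- `unitaryGroupEquiv = toUnits` as functions (definitional). [folklore] -/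
@[simp] theorem unitaryGroupEquiv_apply (g : unitaryGroup F) :
    unitaryGroupEquiv F g = toUnits F g := rfl

/-- `unitaryGroupEquiv.symm = ofUnits` as functions (definitional). [folklore] -/
@[simp] theorem unitaryGroupEquiv_symm_apply (a : Fˣ) :
    (unitaryGroupEquiv F).symm a = ofUnits F a := rfl

/-- In coordinates: `g = (a, a⁻¹)` for every `g ∈ U`, `a := unitaryGroupEquiv F g`. [folklore] -/
theorem coe_eq_pair (g : unitaryGroup F) :
    ((g : (F × F)ˣ) : F × F)
      = ((unitaryGroupEquiv F g : F), (((unitaryGroupEquiv F g)⁻¹ : Fˣ) : F)) :=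
  Prod.ext rfl (coe_toUnits_inv F g).symm

/-! ### §3 The same for the Gram-matrix unitary group `ShimuraVarieties.unitaryGroup σ H` of a
non-degenerate hermitian line -/

section GramMatrixLine

open Matrix Literature.AlgebraicGeometry

variable {R : Type*} [CommRing R] {m : Type*} [Fintype m] [Unique m]

/-- `1 × 1` matrices: `Matrix m m R ≃+* R`, `M ↦ M default default`, for a one-point index type `m`
with an ARBITRARY `[Fintype m]` instance (Mathlib's `Matrix.uniqueRingEquiv` is the same map stated
over the instance `Unique.fintype`, so it does not apply to `GL m R` for a given `[Fintype m]` verbatim;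
cf. `FramedRep.unitsContinuousMulEquivOfUnique`). [folklore] -/
def matrixUniqueEquiv : Matrix m m R ≃+* R where
  toFun M := M default default
  invFun a := Matrix.of fun _ _ => a
  left_inv M := by
    ext i j
    obtain rfl : i = default := Unique.eq_default i
    obtain rfl : j = default := Unique.eq_default j
    rfl
  right_inv a := rfl
  map_mul' M N := by simp only [Matrix.mul_apply, Fintype.sum_unique]
  map_add' M N := rfl

/-- `matrixUniqueEquiv M = M default default` (definitional). [folklore] -/
@[simp] theorem matrixUniqueEquiv_apply (M : Matrix m m R) :
    matrixUniqueEquiv M = M default default := rfl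

variable [DecidableEq m]

/-- `GL₁(R) ≃* Rˣ` (units of `matrixUniqueEquiv`). [folklore] -/
def glUniqueEquiv : GL m R ≃* Rˣ :=
  Units.mapEquiv (matrixUniqueEquiv (R := R) (m := m)).toMulEquiv

/-- `glUniqueEquiv g = g₁₁` on underlying elements (definitional). [folklore] -/
@[simp] theorem coe_glUniqueEquiv (g : GL m R) :
    (glUniqueEquiv g : R) = (g : Matrix m m R) default default := rfl

/-- The single entry of `glUniqueEquiv.symm u` is `u` (definitional). [folklore] -/
@[simp] theorem coe_glUniqueEquiv_symm (u : Rˣ) :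
    ((glUniqueEquiv (m := m)).symm u : Matrix m m R) default default = (u : R) := rfl

/-- Membership in the Gram-matrix unitary group `unitaryGroup σ H` (`(σg)ᵀ H g = H`) of a
NON-DEGENERATE hermitian line `H = (δ)`, `δ` a unit: `g ∈ U(H) ↔ σ(g₁₁) g₁₁ = 1` — the form cancels.
[folklore] -/
theorem mem_unitaryGroup_line_iff (σ : R →+* R) (H : Matrix m m R) (hH : IsUnit (H default default))
    (g : GL m R) :
    g ∈ ShimuraVarieties.unitaryGroup σ H ↔
      σ ((g : Matrix m m R) default default) * (g : Matrix m m R) default default = 1 := by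
  rw [ShimuraVarieties.mem_unitaryGroup_iff]
  constructor
  · intro h
    have h1 := congr_fun (congr_fun h default) default
    simp only [Matrix.mul_apply, Fintype.sum_unique, transpose_apply, Matrix.map_apply] at h1
    refine hH.mul_right_cancel ?_
    rw [one_mul]
    calc σ ((g : Matrix m m R) default default) * (g : Matrix m m R) default default * H default default
        = σ ((g : Matrix m m R) default default) * H default default
            * (g : Matrix m m R) default default := by ring
      _ = H default default := h1
  · intro h
    ext i j
    obtain rfl : i = default := Unique.eq_default i
    obtain rfl : j = default := Unique.eq_default j
    simp only [Matrix.mul_apply, Fintype.sum_unique, transpose_apply, Matrix.map_apply]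
    calc σ ((g : Matrix m m R) default default) * H default default * (g : Matrix m m R) default default
        = σ ((g : Matrix m m R) default default) * (g : Matrix m m R) default default
            * H default default := by ring
      _ = H default default := by rw [h, one_mul]

variable (F : Type*) [CommRing F]

/-- Under `GL₁(F × F) ≃* (F × F)ˣ` the Gram-matrix unitary group `U(H)` of a non-degenerate hermitian
line over the split algebra (involution = the flip) is the norm-one group `unitaryGroup F` — in
particular it does not depend on `H`. [folklore] -/
theorem map_glUniqueEquiv_unitaryGroup (H : Matrix m m (F × F)) (hH : IsUnit (H default default)) :
    (ShimuraVarieties.unitaryGroup (conj F).toRingHom H).map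
        (glUniqueEquiv (R := F × F) (m := m)).toMonoidHom
      = unitaryGroup F := by
  ext g
  rw [Subgroup.mem_map, mem_unitaryGroup_iff]
  constructor
  · rintro ⟨g', hg', rfl⟩
    rw [mem_unitaryGroup_line_iff _ _ hH] at hg'
    rw [mul_comm]; exact hg'
  · intro hg
    refine ⟨(glUniqueEquiv (m := m)).symm g, ?_, MulEquiv.apply_symm_apply _ _⟩
    rw [mem_unitaryGroup_line_iff _ _ hH, coe_glUniqueEquiv_symm, mul_comm]
    exact hg

/-- **`U(H) ≃* Fˣ` for the Gram-matrix unitary group of a non-degenerate hermitian LINE `H = (δ)` over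
the split algebra `F × F` with the flip involution**: first `GL₁ → units` (`glUniqueEquiv`), then
`unitaryGroupEquiv` (Mok's `ι₁`, `N = 1`). (Name kept from the cell's package, where `unitaryGroup σ H`
is "the package's unitary group".) [cite: Mok2014, §1 Notation p. 5] -/
def packageLineEquiv (H : Matrix m m (F × F)) (hH : IsUnit (H default default)) :
    ShimuraVarieties.unitaryGroup (conj F).toRingHom H ≃* Fˣ :=
  ((MulEquiv.subgroupMap (glUniqueEquiv (R := F × F) (m := m)) _).trans
    (MulEquiv.subgroupCongr (map_glUniqueEquiv_unitaryGroup F H hH))).trans (unitaryGroupEquiv F)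

/-- `packageLineEquiv g = (g₁₁).1` on underlying elements (definitional). [folklore] -/
theorem coe_packageLineEquiv (H : Matrix m m (F × F)) (hH : IsUnit (H default default))
    (g : ShimuraVarieties.unitaryGroup (conj F).toRingHom H) :
    (packageLineEquiv F H hH g : F) = (((g : GL m (F × F)) : Matrix m m (F × F)) default default).1 :=
  rfl

/-- In coordinates: the single entry of `g ∈ U(H)` is `(a, a⁻¹)`, `a := packageLineEquiv F H hH g`.
[folklore] -/
theorem entry_eq_pair (H : Matrix m m (F × F)) (hH : IsUnit (H default default))
    (g : ShimuraVarieties.unitaryGroup (conj F).toRingHom H) :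
    ((g : GL m (F × F)) : Matrix m m (F × F)) default default
      = ((packageLineEquiv F H hH g : F), (((packageLineEquiv F H hH g)⁻¹ : Fˣ) : F)) := by
  have := coe_eq_pair F ((MulEquiv.subgroupMap (glUniqueEquiv (R := F × F) (m := m)) _).trans
    (MulEquiv.subgroupCongr (map_glUniqueEquiv_unitaryGroup F H hH)) g)
  exact this

end GramMatrixLine

end SplitUnitaryLine

end Literature.NumberTheory.QuadraticForms
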